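import Summits.AtomisticToContinuum.HydrodynamicLimit.Theorems.OneFlightGossipEngineEnergyCurrentTailsPedigreeObjects
import HarnessLib

/-!
# Level-census and merge-intake statements of general polynomial order
# (line `pedigree-perpetuity`, crux `EnergyCurrentTails`, stmt-AtomisticToContinuum-9235)

Definitions-only companion of the vocabulary file `…Theorems.OneFlightGossipEngineEnergyCurrentTailsPedigreeObjects`
(lead seat c3, `prover-line-stmt-AtomisticToContinuum-9235-c3-0`), introduced to make the cycle-1 FINDING of the line
machine-checkable: the merge-intake stub is CENSUS-STRENGTH.  `CensusDecayOrder p` is the line's transfer statement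
`CensusDecay` with the exponent `4` replaced by `p` (expected level census `≤ B(N+1)L⁻ᵖ`), and `MergeIntakeTailsOrder p`
is the stub statement `MergeIntakeTails` with the exponent `5` replaced by `p` (`P(Λ ≥ LΘ₀) ≤ B₁L⁻ᵖ`); the two
registered statements are the instances `p = 4`, `p = 5` by `Iff.rfl` (`censusDecay_iff_order_four`,
`mergeIntakeTails_iff_order_five`).  Nothing else is asserted here; the implications between the orders live in
`…Theorems.OneFlightGossipEngineEnergyCurrentTailsPedigreeCircularity`.
-/

noncomputable section

open MeasureTheory Set
open scoped ENNReal

namespace Summit.AtomisticToContinuum.HydrodynamicLimit.Theorems.EnergyCurrentTailsPedigree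

open Literature.MathematicalPhysics.KineticTheory Literature.Analysis.FluidPDE

/-- **CENSUS DECAY OF ORDER `p`**: `CensusDecay` with `L⁻⁴` replaced by `L⁻ᵖ` — in the frame of the crux, for every
`t < T` a level scale `Θ > 0`, a constant `B` and `N₀` with `census(s, L·Θ) ≤ B (N+1) / Lᵖ` for `N ≥ N₀`,
`s ∈ [0,t]`, natural `L ≥ 1`. -/
def CensusDecayOrder (p : ℕ) : Prop :=
  ∀ (a₀ θ₀ : T3 → ℝ) (u₀ : T3 → V3), Continuous a₀ → Continuous θ₀ → Continuous u₀ →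
    (∀ x, 0 < a₀ x) → (∀ x, 0 < θ₀ x) → ∃ σ₀ : ℝ, 0 < σ₀ ∧ ∀ σ : ℝ, 0 < σ → σ < σ₀ →
    ∀ (T : ℝ) (ρ θ : ℝ → T3 → ℝ) (u : ℝ → T3 → V3), IsHardSphereEulerSolution σ T ρ u θ →
    ∀ Φ : (N : ℕ) → HardSphereFlow (Torus.geometry (Fin 3)) (hsDiameter σ N) (N + 1),
      TendstoHydroFieldsAt (fun N => localGibbsLaw σ a₀ u₀ θ₀ N (Φ N)) Φ ρ u θ 0 →
      ∀ t ∈ Set.Ico 0 T, ∃ Θ : ℝ, 0 < Θ ∧ ∃ B : ℝ, ∃ N₀ : ℕ, ∀ N : ℕ, N₀ ≤ N → ∀ s ∈ Set.Icc 0 t,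
        ∀ L : ℕ, 1 ≤ L →
          census σ a₀ θ₀ u₀ N (Φ N) s (L * Θ) ≤ ENNReal.ofReal (B * ((N : ℝ) + 1) / (L : ℝ) ^ p)

/-- **MERGE-INTAKE TAILS OF ORDER `p`**: `MergeIntakeTails` with `L⁻⁵` replaced by `L⁻ᵖ` — in the frame of the crux,
for every `t < T` a thermal threshold `Θ₀ > 0`, a constant `B₁` and `N₀` with `P(Λ ≥ L·Θ₀) ≤ B₁ / Lᵖ` for `N ≥ N₀`,
`s ∈ [0,t]`, every particle `i` and natural `L ≥ 1` (`Λ` the discounted warm intake of the backward lineage of `(i,s)`). -/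
def MergeIntakeTailsOrder (p : ℕ) : Prop :=
  ∀ (a₀ θ₀ : T3 → ℝ) (u₀ : T3 → V3), Continuous a₀ → Continuous θ₀ → Continuous u₀ →
    (∀ x, 0 < a₀ x) → (∀ x, 0 < θ₀ x) → ∃ σ₀ : ℝ, 0 < σ₀ ∧ ∀ σ : ℝ, 0 < σ → σ < σ₀ →
    ∀ (T : ℝ) (ρ θ : ℝ → T3 → ℝ) (u : ℝ → T3 → V3), IsHardSphereEulerSolution σ T ρ u θ →
    ∀ Φ : (N : ℕ) → HardSphereFlow (Torus.geometry (Fin 3)) (hsDiameter σ N) (N + 1),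
      TendstoHydroFieldsAt (fun N => localGibbsLaw σ a₀ u₀ θ₀ N (Φ N)) Φ ρ u θ 0 →
      ∀ t ∈ Set.Ico 0 T, ∃ Θ₀ : ℝ, 0 < Θ₀ ∧ ∃ B₁ : ℝ, ∃ N₀ : ℕ, ∀ N : ℕ, N₀ ≤ N →
        ∀ s ∈ Set.Icc 0 t, ∀ (i : Fin (N + 1)) (L : ℕ), 1 ≤ L →
          (localGibbsLaw σ a₀ u₀ θ₀ N (Φ N))
              {z | (L : ℝ) * Θ₀ ≤ warmIntake (hsDiameter σ N) (fun r => (Φ N).flow r z) Θ₀ i s}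
            ≤ ENNReal.ofReal (B₁ / (L : ℝ) ^ p)

/-- The line's transfer statement `CensusDecay` IS the order-4 census decay (definitionally). -/
theorem censusDecay_iff_order_four : CensusDecay ↔ CensusDecayOrder 4 := Iff.rfl

/-- The registered stub statement `MergeIntakeTails` IS the order-5 merge-intake tail bound (definitionally). -/
theorem mergeIntakeTails_iff_order_five : MergeIntakeTails ↔ MergeIntakeTailsOrder 5 := Iff.rfl

end Summit.AtomisticToContinuum.HydrodynamicLimit.Theorems.EnergyCurrentTailsPedigree

end
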